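import Mathlib
import HarnessLib
import Literature.Analysis.FluidPDE.VectorCalculus
import Summits.NavierStokesRegularity.NavierStokesRegularity.Theorems.UnthreadedDoorAntidynamoEvenRungRadialPsi
import Summits.NavierStokesRegularity.NavierStokesRegularity.Theorems.UnthreadedDoorAntidynamoZonalLemma
import Summits.NavierStokesRegularity.NavierStokesRegularity.Theorems.UnthreadedRigidityDoorUnthreadedRigidityVirialHornAngularJets
import Summits.NavierStokesRegularity.NavierStokesRegularity.Theorems.UnthreadedRigidityDoorUnthreadedRigidityVirialHornAnalyticWedge

/-!
# Route `UnthreadedDoor` / `ThreadingFlux`, crux `PoloidalLiouville` (stmt-NavierStokesRegularity-1222), antidynamo v2 skeleton,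
# rung `stub_singleDegreeRung`, EVEN degree — THE (E3) EXTRACTION: sphere constancy of `Ψ` on ONE sphere with `d ≠ 0`
# forces the quadratic sphere law, hence `l = 2` and `P` zonal; in degree `l ≥ 3` it forces `d ≡ 0`

Support file (census instrument decomp-ns-census-1 g31, cell decomp-ns; `--supports stmt-NavierStokesRegularity-1222 --as helper`; 0 kit).

The leaf hand's bridge (E2)→(E3) `psi_sphereConst_of_lamb_identity` (p800631, `…AntidynamoEvenRungRadialPsi`) turns the single-degree
vorticity identity `−(c(r)P)•(∇P × y) − d(r)•(∇|∇P|² × y) − e(r)•(∇P × y) = 0` (`y ≠ 0`) into: the scalar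
`Ψ(y) = −½c(‖y‖)P(y)² − d(‖y‖)|∇P(y)|² − e(‖y‖)P(y)` is CONSTANT ON EVERY SPHERE about the centre.  The census's zonal lemma
`gradSqQuadraticLaw` (p809884, `…AntidynamoZonalLemma`) says a nonzero solid harmonic of degree `l ≥ 2` with
`‖∇P‖² = a + bP + cP²` on `S²` has `l = 2` and is zonal.  THIS FILE IS THE POINTWISE ALGEBRA IN BETWEEN (hand g1's step «(E3)
separation», named S-sized in the cell's census v30, rows D31/H02):

* `quadraticSphereLaw_of_psi_const_on_sphere` — ONE sphere `‖y‖ = ρ > 0`, constants `c₀ d₀ e₀ K` with `d₀ ≠ 0`: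
  `−½c₀P² − d₀⟪∇P,∇P⟫ − e₀P = K` on that sphere ⟹ `∃ a b c, ‖∇P‖² = a + bP + cP²` on `S²` (homogeneity
  `P(ρy) = ρ^l P(y)`, `∇P(ρy) = ρ^{l−1}∇P(y)` — the tree's `IsSolidHarmonic.apply_smul` / `gradient_smul` — and division by `d₀ρ^{2l−2}`);
* ★ `evenRung_separation` — sphere constancy of `Ψ` in the letter of p800631's conclusion + `∃ ρ > 0, d ρ ≠ 0` ⟹ `l = 2 ∧ IsZonal P`;
* ★★ `evenRung_separation_of_lamb_identity` — the same straight from the identity (hypotheses of p800631: `c d e` differentiable on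
  `(0,∞)`; `P ∈ C²` is automatic for a solid harmonic);
* ★★ `evenRung_dichotomy_of_lamb_identity` — the identity forces `(∀ ρ > 0, d ρ = 0) ∨ (l = 2 ∧ IsZonal P)`: the even rung splits into
  the `d ≡ 0` ODE branch and the zonal quadratic (axisymmetric, KNSS) sector;
* `d_eq_zero_of_lamb_identity_of_three_le` — in degree `l ≥ 3` the identity forces `d ≡ 0` on `(0,∞)`;
* `evenRung_separation_of_laplacian` / `evenRung_dichotomy_of_laplacian` — the same in the LETTER of `StubSingleDegreeRung`
  (`P : MvPolynomial (Fin 3) ℝ`, harmonicity via Mathlib's `Laplacian.laplacian` of `z ↦ eval z P`, zonality as `det3 a y (∇P y) = 0`).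

What remains of the even rung after this file (hand g1's plan, census v30 row H02): the `d ≡ 0` ODE branch, the (E1) assembly at the
centre, and the KNSS transfer for the zonal quadratic; the WALL `stub_scalarLiouville` is untouched.

HONEST LABEL: elementary homogeneity algebra serving the open EVEN-degree rung of an S-free Liouville engine; the rung, the wall,
`PoloidalLiouville` (1222) and Navier–Stokes regularity are NOT touched (crux 1222 is INCOMPARABLE with the summit; this is descent inside
the door's cone, decorative for the summit).  Nothing here proves NavierStokesRegularity.  [folklore]
-/

noncomputable section

-- the summit and its single sub-problem share the name (CONVENTIONS §1), as in every Theorems file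
set_option linter.dupNamespace false

open scoped Topology InnerProductSpace RealInnerProductSpace ContDiff
open Literature.Analysis.FluidPDE

namespace Summit.NavierStokesRegularity.NavierStokesRegularity.Theorems.PoloidalLiouville.Antidynamo

-- `Zonal.*` = the W1 polynomial calculus (`evalE`, `lapP`, …) of `…Theorems.PoloidalLiouville.HorizonTower.Zonal`
open Summit.NavierStokesRegularity.NavierStokesRegularity.Theorems.PoloidalLiouville.HorizonTower
open Summit.NavierStokesRegularity.NavierStokesRegularity.Theorems.UnthreadedRigidity.VirialHorn
  (IsSolidHarmonic IsZonal IsZonalAbout det3 isSolidHarmonic_evalE)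

/-! ### One sphere: constancy of `Ψ` with `d₀ ≠ 0` gives the quadratic sphere law -/

/-- **ONE-SPHERE EXTRACTION.**  `Y` a solid harmonic of degree `l`; on the sphere `‖y‖ = ρ > 0` suppose
`−½c₀·Y² − d₀·⟪∇Y,∇Y⟫ − e₀·Y = K` with constants and `d₀ ≠ 0`.  Then `‖∇Y‖² = a + b·Y + c·Y²` on the UNIT sphere for suitable
constants (homogeneity `Y(ρy) = ρ^l Y(y)`, `∇Y(ρy) = ρ^{l−1}∇Y(y)`, then divide by `d₀ρ^{2l−2}`). [folklore] -/
theorem quadraticSphereLaw_of_psi_const_on_sphere {l : ℕ} {Y : EuclideanSpace ℝ (Fin 3) → ℝ} (hY : IsSolidHarmonic l Y)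
    {ρ c₀ d₀ e₀ K : ℝ} (hρ : 0 < ρ) (hd : d₀ ≠ 0)
    (hΨ : ∀ y : EuclideanSpace ℝ (Fin 3), ‖y‖ = ρ →
      -(1 / 2) * c₀ * (Y y * Y y) - d₀ * ⟪gradient Y y, gradient Y y⟫ - e₀ * Y y = K) :
    ∃ a b c : ℝ, ∀ y : EuclideanSpace ℝ (Fin 3), ‖y‖ = 1 → ‖gradient Y y‖ ^ 2 = a + b * Y y + c * Y y ^ 2 := by
  set σ : ℝ := ρ ^ ((l : ℤ) - 1) with hσ
  have hσ0 : 0 < σ := zpow_pos hρ _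
  have hD : d₀ * σ ^ 2 ≠ 0 := mul_ne_zero hd (pow_ne_zero _ hσ0.ne')
  refine ⟨-K / (d₀ * σ ^ 2), -(e₀ * ρ ^ l) / (d₀ * σ ^ 2), -((1 / 2) * c₀ * (ρ ^ l) ^ 2) / (d₀ * σ ^ 2), fun y hy => ?_⟩
  have hnorm : ‖ρ • y‖ = ρ := by rw [norm_smul, Real.norm_eq_abs, abs_of_pos hρ, hy, mul_one]
  have h := hΨ (ρ • y) hnorm
  rw [hY.apply_smul ρ y, hY.gradient_smul ρ hρ y, ← hσ, real_inner_smul_left, real_inner_smul_right,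
    real_inner_self_eq_norm_sq] at h
  have hmain : ‖gradient Y y‖ ^ 2 =
      (-K - e₀ * ρ ^ l * Y y - (1 / 2) * c₀ * (ρ ^ l) ^ 2 * Y y ^ 2) / (d₀ * σ ^ 2) :=
    eq_div_of_mul_eq hD (by linear_combination -h)
  rw [hmain]
  ring

/-! ### All spheres: the (E3) separation -/

/-- ★ **(E3) SEPARATION.**  `Y` a nonzero solid harmonic of degree `l ≥ 2`, `c d e : ℝ → ℝ` radial coefficients.  If
`Ψ(y) = −½c(‖y‖)Y(y)² − d(‖y‖)⟪∇Y(y),∇Y(y)⟫ − e(‖y‖)Y(y)` is constant on every sphere about the centre (stated in the letter of the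
conclusion of `psi_sphereConst_of_lamb_identity`, p800631) and `d ρ ≠ 0` for SOME `ρ > 0`, then `l = 2` and `Y` is zonal
(`gradSqQuadraticLaw`, p809884, on the quadratic sphere law extracted from that one sphere). [folklore] -/
theorem evenRung_separation {l : ℕ} {Y : EuclideanSpace ℝ (Fin 3) → ℝ} (hl : 2 ≤ l) (hY : IsSolidHarmonic l Y)
    (hne : ∃ y, Y y ≠ 0) {c d e : ℝ → ℝ}
    (hΨ : ∀ y₁ y₂ : EuclideanSpace ℝ (Fin 3), y₁ ≠ 0 → ‖y₁‖ = ‖y₂‖ →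
      (-(1 / 2) * c ‖y₁‖ * (Y y₁ * Y y₁) - d ‖y₁‖ * ⟪gradient Y y₁, gradient Y y₁⟫ - e ‖y₁‖ * Y y₁) =
        (-(1 / 2) * c ‖y₂‖ * (Y y₂ * Y y₂) - d ‖y₂‖ * ⟪gradient Y y₂, gradient Y y₂⟫ - e ‖y₂‖ * Y y₂))
    (hdρ : ∃ ρ, 0 < ρ ∧ d ρ ≠ 0) :
    l = 2 ∧ IsZonal Y := by
  obtain ⟨ρ, hρ, hd⟩ := hdρ
  -- a reference point on the sphere of radius `ρ`
  set y₀ : EuclideanSpace ℝ (Fin 3) := ρ • EuclideanSpace.single 0 1 with hy₀def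
  have hy₀ : ‖y₀‖ = ρ := by
    rw [hy₀def, norm_smul, Real.norm_eq_abs, abs_of_pos hρ]
    simp
  refine gradSqQuadraticLaw l Y hl hY hne
    (quadraticSphereLaw_of_psi_const_on_sphere hY hρ hd (c₀ := c ρ) (e₀ := e ρ)
      (K := -(1 / 2) * c ρ * (Y y₀ * Y y₀) - d ρ * ⟪gradient Y y₀, gradient Y y₀⟫ - e ρ * Y y₀) fun y hy => ?_)
  have hy0 : y ≠ 0 := by rw [← norm_ne_zero_iff, hy]; exact hρ.ne'
  have h := hΨ y y₀ hy0 (hy.trans hy₀.symm)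
  rwa [hy, hy₀] at h

/-- ★★ **(E3) FROM THE LAMB IDENTITY.**  `Y` a nonzero solid harmonic of degree `l ≥ 2`; `c d e` differentiable on `(0,∞)`; the
single-degree vorticity identity `−(c(‖y‖)Y(y))•(∇Y(y) × y) − d(‖y‖)•(∇|∇Y|²(y) × y) − e(‖y‖)•(∇Y(y) × y) = 0` for all `y ≠ 0`
(the form delivered by `curl_lamb_eq_radial`, p800175, and consumed by `psi_sphereConst_of_lamb_identity`, p800631); if `d ρ ≠ 0` for
some `ρ > 0` then `l = 2` and `Y` is zonal. [folklore] -/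
theorem evenRung_separation_of_lamb_identity {l : ℕ} {Y : EuclideanSpace ℝ (Fin 3) → ℝ} (hl : 2 ≤ l)
    (hY : IsSolidHarmonic l Y) (hne : ∃ y, Y y ≠ 0) {c d e : ℝ → ℝ}
    (hc : ∀ r, 0 < r → DifferentiableAt ℝ c r) (hd : ∀ r, 0 < r → DifferentiableAt ℝ d r)
    (he : ∀ r, 0 < r → DifferentiableAt ℝ e r)
    (hid : ∀ y : EuclideanSpace ℝ (Fin 3), y ≠ 0 →
      -((c ‖y‖ * Y y) • cross (gradient Y y) y) - d ‖y‖ • cross (gradient (fun z => ⟪gradient Y z, gradient Y z⟫) y) y -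
        e ‖y‖ • cross (gradient Y y) y = 0)
    (hdρ : ∃ ρ, 0 < ρ ∧ d ρ ≠ 0) :
    l = 2 ∧ IsZonal Y :=
  evenRung_separation hl hY hne
    (fun _ _ hy₁ hn => psi_sphereConst_of_lamb_identity (hY.contDiff.of_le (by norm_cast)) hc hd he hid hy₁ hn) hdρ

/-- ★★ **THE EVEN RUNG SPLITS.**  Under the single-degree vorticity identity (hypotheses of
`evenRung_separation_of_lamb_identity` without the non-vanishing of `d`): EITHER `d ≡ 0` on `(0,∞)` (the ODE branch of the even rung)
OR `l = 2` and `Y` is zonal (the axisymmetric sector). [folklore] -/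
theorem evenRung_dichotomy_of_lamb_identity {l : ℕ} {Y : EuclideanSpace ℝ (Fin 3) → ℝ} (hl : 2 ≤ l)
    (hY : IsSolidHarmonic l Y) (hne : ∃ y, Y y ≠ 0) {c d e : ℝ → ℝ}
    (hc : ∀ r, 0 < r → DifferentiableAt ℝ c r) (hd : ∀ r, 0 < r → DifferentiableAt ℝ d r)
    (he : ∀ r, 0 < r → DifferentiableAt ℝ e r)
    (hid : ∀ y : EuclideanSpace ℝ (Fin 3), y ≠ 0 →
      -((c ‖y‖ * Y y) • cross (gradient Y y) y) - d ‖y‖ • cross (gradient (fun z => ⟪gradient Y z, gradient Y z⟫) y) y -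
        e ‖y‖ • cross (gradient Y y) y = 0) :
    (∀ ρ, 0 < ρ → d ρ = 0) ∨ (l = 2 ∧ IsZonal Y) := by
  by_cases h : ∃ ρ, 0 < ρ ∧ d ρ ≠ 0
  · exact Or.inr (evenRung_separation_of_lamb_identity hl hY hne hc hd he hid h)
  · push Not at h
    exact Or.inl h

/-- **DEGREE `l ≥ 3`: THE IDENTITY FORCES `d ≡ 0`** on `(0,∞)` (no nonzero solid harmonic of degree `≥ 3` obeys a quadratic sphere
law, `not_quadraticSphereLaw_of_three_le`). [folklore] -/
theorem d_eq_zero_of_lamb_identity_of_three_le {l : ℕ} {Y : EuclideanSpace ℝ (Fin 3) → ℝ} (hl : 3 ≤ l)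
    (hY : IsSolidHarmonic l Y) (hne : ∃ y, Y y ≠ 0) {c d e : ℝ → ℝ}
    (hc : ∀ r, 0 < r → DifferentiableAt ℝ c r) (hd : ∀ r, 0 < r → DifferentiableAt ℝ d r)
    (he : ∀ r, 0 < r → DifferentiableAt ℝ e r)
    (hid : ∀ y : EuclideanSpace ℝ (Fin 3), y ≠ 0 →
      -((c ‖y‖ * Y y) • cross (gradient Y y) y) - d ‖y‖ • cross (gradient (fun z => ⟪gradient Y z, gradient Y z⟫) y) y -
        e ‖y‖ • cross (gradient Y y) y = 0) :
    ∀ ρ, 0 < ρ → d ρ = 0 := by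
  rcases evenRung_dichotomy_of_lamb_identity (by omega) hY hne hc hd he hid with h | ⟨h2, -⟩
  · exact h
  · omega

/-! ### The letter of `StubSingleDegreeRung`: polynomial `P`, Mathlib's Laplacian, `det3`-zonality -/

/-- ★★ **(E3) IN THE RUNG'S LETTER.**  `P` a real homogeneous polynomial of degree `l ≥ 2`, the polynomial FUNCTION
`z ↦ eval z P` harmonic (Mathlib's `Laplacian.laplacian`) and nonzero somewhere; `c d e` differentiable on `(0,∞)`; the single-degree
vorticity identity for that function off the centre; `d ρ ≠ 0` for some `ρ > 0`.  Then `l = 2` and `∇P` is coaxial: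
`det3 a y (∇P y) = 0` for a fixed `a ≠ 0` and all `y`. [folklore] -/
theorem evenRung_separation_of_laplacian {l : ℕ} {P : MvPolynomial (Fin 3) ℝ} (hl : 2 ≤ l) (hP : P.IsHomogeneous l)
    (hlap : ∀ y : EuclideanSpace ℝ (Fin 3),
      Laplacian.laplacian (fun z : EuclideanSpace ℝ (Fin 3) => MvPolynomial.eval (fun i => z i) P) y = 0)
    (h0 : ∃ y : EuclideanSpace ℝ (Fin 3), MvPolynomial.eval (fun i => y i) P ≠ 0) {c d e : ℝ → ℝ}
    (hc : ∀ r, 0 < r → DifferentiableAt ℝ c r) (hd : ∀ r, 0 < r → DifferentiableAt ℝ d r)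
    (he : ∀ r, 0 < r → DifferentiableAt ℝ e r)
    (hid : ∀ y : EuclideanSpace ℝ (Fin 3), y ≠ 0 →
      -((c ‖y‖ * MvPolynomial.eval (fun i => y i) P) •
          cross (gradient (fun z : EuclideanSpace ℝ (Fin 3) => MvPolynomial.eval (fun i => z i) P) y) y) -
        d ‖y‖ • cross (gradient (fun z : EuclideanSpace ℝ (Fin 3) =>
          ⟪gradient (fun w : EuclideanSpace ℝ (Fin 3) => MvPolynomial.eval (fun i => w i) P) z,
            gradient (fun w : EuclideanSpace ℝ (Fin 3) => MvPolynomial.eval (fun i => w i) P) z⟫) y) y -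
        e ‖y‖ • cross (gradient (fun z : EuclideanSpace ℝ (Fin 3) => MvPolynomial.eval (fun i => z i) P) y) y = 0)
    (hdρ : ∃ ρ, 0 < ρ ∧ d ρ ≠ 0) :
    l = 2 ∧ ∃ a : EuclideanSpace ℝ (Fin 3), a ≠ 0 ∧ ∀ y : EuclideanSpace ℝ (Fin 3),
      det3 a y (gradient (fun z : EuclideanSpace ℝ (Fin 3) => MvPolynomial.eval (fun i => z i) P) y) = 0 := by
  have hlapP : Zonal.lapP P = 0 := by
    apply Zonal.eq_zero_of_evalE_eq_zero
    intro y
    rw [← Zonal.laplacian_evalE]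
    exact hlap y
  exact evenRung_separation_of_lamb_identity (Y := Zonal.evalE P) hl (isSolidHarmonic_evalE hP hlapP) h0 hc hd he hid hdρ

/-- ★★ **THE EVEN RUNG SPLITS, IN THE RUNG'S LETTER**: under the single-degree vorticity identity for the polynomial function
`z ↦ eval z P` (degree `l ≥ 2`, harmonic, nonzero somewhere), EITHER `d ≡ 0` on `(0,∞)` OR `l = 2` with `∇P` coaxial. [folklore] -/
theorem evenRung_dichotomy_of_laplacian {l : ℕ} {P : MvPolynomial (Fin 3) ℝ} (hl : 2 ≤ l) (hP : P.IsHomogeneous l)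
    (hlap : ∀ y : EuclideanSpace ℝ (Fin 3),
      Laplacian.laplacian (fun z : EuclideanSpace ℝ (Fin 3) => MvPolynomial.eval (fun i => z i) P) y = 0)
    (h0 : ∃ y : EuclideanSpace ℝ (Fin 3), MvPolynomial.eval (fun i => y i) P ≠ 0) {c d e : ℝ → ℝ}
    (hc : ∀ r, 0 < r → DifferentiableAt ℝ c r) (hd : ∀ r, 0 < r → DifferentiableAt ℝ d r)
    (he : ∀ r, 0 < r → DifferentiableAt ℝ e r)
    (hid : ∀ y : EuclideanSpace ℝ (Fin 3), y ≠ 0 →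
      -((c ‖y‖ * MvPolynomial.eval (fun i => y i) P) •
          cross (gradient (fun z : EuclideanSpace ℝ (Fin 3) => MvPolynomial.eval (fun i => z i) P) y) y) -
        d ‖y‖ • cross (gradient (fun z : EuclideanSpace ℝ (Fin 3) =>
          ⟪gradient (fun w : EuclideanSpace ℝ (Fin 3) => MvPolynomial.eval (fun i => w i) P) z,
            gradient (fun w : EuclideanSpace ℝ (Fin 3) => MvPolynomial.eval (fun i => w i) P) z⟫) y) y -
        e ‖y‖ • cross (gradient (fun z : EuclideanSpace ℝ (Fin 3) => MvPolynomial.eval (fun i => z i) P) y) y = 0) :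
    (∀ ρ, 0 < ρ → d ρ = 0) ∨
      (l = 2 ∧ ∃ a : EuclideanSpace ℝ (Fin 3), a ≠ 0 ∧ ∀ y : EuclideanSpace ℝ (Fin 3),
        det3 a y (gradient (fun z : EuclideanSpace ℝ (Fin 3) => MvPolynomial.eval (fun i => z i) P) y) = 0) := by
  by_cases h : ∃ ρ, 0 < ρ ∧ d ρ ≠ 0
  · exact Or.inr (evenRung_separation_of_laplacian hl hP hlap h0 hc hd he hid h)
  · push Not at h
    exact Or.inl h

end Summit.NavierStokesRegularity.NavierStokesRegularity.Theorems.PoloidalLiouville.Antidynamo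

end
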